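import Literature.NumberTheory.LFunctions.DeuringZeroSpacingPhenomenon
import Literature.NumberTheory.LFunctions.RealZeroEffectiveRepulsionEven
import Literature.NumberTheory.LFunctions.DirichletLDerivativeLogSqBound
import Literature.NumberTheory.QuadraticFields.ImaginaryResiduePiForm
import Literature.Barriers.Parity.SiegelZeroDichotomy
import HarnessLib

/-!
# Odd real characters: `w_K = 2` gives the floor `√q·L(1,χ) ≥ π` — kernel repulsion
# `1 − β ≥ π/(√q (log q)²)` and the quality cap `η ≤ √q log q/π` (PROVED only; debt 0)

Topic `Literature/NumberTheory/LFunctions`, namespace `Literature.NumberTheory.LFunctions.RealZeroRepulsion`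
(companion of `RealZeroEffectiveRepulsionEven.lean`). Cell `parity-realchar` (SIEGEL INSTRUMENT),
TARGET §2 row 16 — the ODD column sharpened by the factor `π/0.69 ≈ 4.5`.

For an ODD primitive quadratic character `χ` mod `D` the field `K = ℚ(√−D)` is imaginary quadratic and
`L(1,χ) = 2π h_K/(w_K √D)`. The tree's floor `√D·L(1,χ) ≥ 2π/9` (`DeuringZeroSpacingPhenomenon.lean`)
used only `w_K ≤ 9`; with the tree's `torsionOrder_eq_two_of_discr_lt_neg_four` (`w_K = 2` for
`d_K < −4`, `ImaginaryResiduePiForm.lean`) and `h_K ≥ 1`: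

  `√D · L(1, χ) = π h_K ≥ π`   (odd primitive quadratic `χ` mod `D ≥ 5`).

With the kernel's explicit (11.10) upper half (`‖L(1,χ)‖ ≤ (1−β) log²q` at a real zero
`β ≥ 1 − 1/(40 log q)`, `q ≥ 232`; `≤ 0.46 (1−β) log²q` for `q ≥ 10⁶`):

* `one_sub_realZero_ge_pi_of_odd` — **`1 − β ≥ π/(√q (log q)²)`** for every odd primitive quadratic `χ`
  mod `q ≥ 1600` and every real zero `β` (both-parity kernel v2: `2/(3 √q log²q)`; gain `3π/2 ≈ 4.7`);
  `_of_ge_1e6`: `(50π/23)/(√q log²q) ≈ 6.83/(√q log²q)` for `q ≥ 10⁶` (v2: `3/2`).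
* `isSiegelZero_quality_le_of_odd` — `η ≤ √q log q/π`; `isSiegelZero_conductor_ge_of_odd` —
  `√q log q ≥ πη`.
* Appended (both parities, TARGET §2 row 16 v3): `one_sub_realZero_ge_pi` — **`1 − β ≥ π/(√q log²q)` for
  EVERY primitive quadratic `χ` mod `q ≥ 1600`** (even: `log(q/4) > π`); `one_sub_realZero_ge_pi_of_ge_1e6`
  (`50π/23 ≈ 6.83`, `q ≥ 10⁶`); `isSiegelZero_quality_le_pi` (`η ≤ √q log q/π`, `πη ≤ √q log q`).

Print comparators (odd): Bordignon 2019 `800/(√q log²q)` (`q > 4·10⁵`); Ralaivaosaona–Razakarinoro 2026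
`6.035/√d` (`d > 3·10⁸`, no logarithm) — both named facts in the tree and both stronger numerically;
the point here is the kernel constant, table-free from `q = 1600`.

## References

* [NeukirchANT1999] Ch. VII §5 (5.11) (class number formula, tree).
* [Oesterle1988Gauss] II §1 (`w = 2` for `d ≠ 3, 4`, tree `torsionOrder_eq_two_of_discr_lt_neg_four`).
* [MontgomeryVaughan2007] Theorem 11.4 (11.10) (explicit upper half, tree).
* [TaoTeravainen2021] Definition 1.4 (`IsSiegelZero`).
-/

noncomputable section

open Complex
open Module NumberField NumberField.InfinitePlace NumberField.Units
open Literature.Barriers.Parity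
open Literature.NumberTheory.QuadraticFields Literature.NumberTheory.QuadraticFields.Quadratic

namespace Literature.NumberTheory.LFunctions

namespace RealZeroRepulsion

/-- **`√D · L(1, χ) ≥ π` for every ODD real primitive character `χ` mod `D ≥ 5`** (class number
formula with `h_K ≥ 1` and `w_K = 2` for `d_K = −D < −4`). [cite: NeukirchANT1999, Ch. VII §5 (5.11)]
[cite: Oesterle1988Gauss, II §1 p. 53] -/
theorem sqrt_mul_norm_LFunction_one_ge_pi_of_odd {D : ℕ} [NeZero D] (hD : 5 ≤ D)
    {χ : DirichletCharacter ℂ D} (hprim : χ.IsPrimitive) (hquad : χ.IsQuadratic) (hodd : χ.Odd) :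
    Real.pi ≤ Real.sqrt D * ‖χ.LFunction 1‖ := by
  classical
  obtain ⟨K, instF, instNF, h2, hdK⟩ := exists_numberField_discr_eq
    (PrimitiveQuadratic.isFundamentalDiscriminant_neg hprim hquad hodd)
  have hD0 : 0 < D := by omega
  have hd : NumberField.discr K < 0 := by
    rw [hdK, neg_lt_zero]; exact_mod_cast hD0
  have hd4 : NumberField.discr K < -4 := by
    rw [hdK]; have : (5 : ℤ) ≤ D := by exact_mod_cast hD
    omega
  -- `χ ≠ 1` (it is odd)
  have hχ1 : χ ≠ 1 := by
    intro h1
    have h : χ (-1) = -1 := hodd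
    rw [h1] at h
    have hu : IsUnit (-1 : ZMod D) := isUnit_one.neg
    rw [MulChar.one_apply hu] at h
    norm_num at h
  -- `ζ_K = ζ · L(χ)` on `Re s > 1`
  have hζ : ∀ s : ℝ, 1 < s →
      NumberField.dedekindZeta K s = riemannZeta s * LSeries (fun n => χ n) s := by
    intro s hs
    refine dedekindZeta_eq_riemannZeta_mul_LSeries_of_kronecker h2 χ ?_ ?_ (by simpa using hs)
    · intro p hp hp2
      haveI := Fact.mk hp
      rw [hdK, PrimitiveQuadratic.apply_prime_eq_legendreSym_neg_of_odd hprim hquad hodd p hp2,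
        jacobiSym.legendreSym.to_jacobiSym]
    · rw [hdK]
      rcases Nat.even_or_odd D with hev | hod
      · have h8a : (-(D : ℤ)) % 8 ≠ 1 := by obtain ⟨k, hk⟩ := hev; omega
        have h8b : (-(D : ℤ)) % 8 ≠ 5 := by obtain ⟨k, hk⟩ := hev; omega
        rw [if_neg h8a, if_neg h8b, PrimitiveQuadratic.apply_two_of_even hev χ]
      · by_cases h1 : (-(D : ℤ)) % 8 = 1
        · rw [if_pos h1, PrimitiveQuadratic.apply_two_eq_one_of_odd hod hprim hquad hodd h1]
        · have h4 : D % 4 = 3 := PrimitiveQuadratic.mod_four_eq_three_of_odd hod hprim hquad hodd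
          have h5 : (-(D : ℤ)) % 8 = 5 := by omega
          rw [if_neg h1, if_pos h5, PrimitiveQuadratic.apply_two_eq_neg_one_of_odd hod hprim hquad hodd h5]
  -- class number formula with `w = 2`
  have hL := LFunction_one_eq_of_discr_neg_of_eq h2 hd hχ1 hζ
  have habs : |(NumberField.discr K : ℝ)| = (D : ℝ) := by
    rw [hdK]; push_cast; rw [abs_neg]; exact abs_of_nonneg (Nat.cast_nonneg D)
  rw [habs] at hL
  have hw : torsionOrder K = 2 := torsionOrder_eq_two_of_discr_lt_neg_four h2 hd4
  have hh : (1 : ℝ) ≤ NumberField.classNumber K := by exact_mod_cast NumberField.classNumber_pos K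
  have hsqrt : 0 < Real.sqrt D := Real.sqrt_pos.mpr (by exact_mod_cast hD0)
  have hval : ‖χ.LFunction 1‖ = Real.pi * NumberField.classNumber K / Real.sqrt D := by
    rw [hL, hw, Complex.norm_real, Real.norm_eq_abs, abs_of_nonneg (by positivity)]
    push_cast
    field_simp
  rw [hval]
  have hsimp : Real.sqrt D * (Real.pi * NumberField.classNumber K / Real.sqrt D) =
      Real.pi * NumberField.classNumber K := by field_simp
  rw [hsimp]
  nlinarith [Real.pi_pos]

/-- `log q > 7` for `q ≥ 1600` (`e⁷ < 1097`). [folklore] -/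
private theorem seven_lt_log' {q : ℕ} (hq : 1600 ≤ q) : 7 < Real.log q := by
  have hq' : (1600 : ℝ) ≤ q := by exact_mod_cast hq
  rw [Real.lt_log_iff_exp_lt (by linarith)]
  have h1 : Real.exp (1 : ℝ) < 2.7182818286 := Real.exp_one_lt_d9
  have h7 : Real.exp (7 : ℝ) = Real.exp 1 ^ 7 := by rw [Real.exp_one_pow]; norm_num
  rw [h7]
  have h0 : 0 < Real.exp (1 : ℝ) := Real.exp_pos 1
  nlinarith [pow_le_pow_left₀ h0.le h1.le 7]

/-- `π < 3.15`, as used below. [folklore] -/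
private theorem pi_lt_315 : Real.pi < 3.15 := by
  have := Real.pi_lt_d2; linarith

/-- **Kernel repulsion for ODD characters: `1 − β ≥ π/(√q (log q)²)`** for every odd primitive quadratic
`χ` mod `q ≥ 1600` and every real zero `β` of `L(s,χ)` (near zeros: `π/√q ≤ ‖L(1,χ)‖ ≤ (1−β) log²q`;
far zeros: `1 − β > 1/(40 log q) ≥ π/(√q log²q)` because `√q log q ≥ 40·7 > 40π`).
[cite: MontgomeryVaughan2007, Theorem 11.4 (11.10)] [cite: NeukirchANT1999, Ch. VII §5 (5.11)] -/
theorem one_sub_realZero_ge_pi_of_odd {q : ℕ} [NeZero q] (hq : 1600 ≤ q)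
    {χ : DirichletCharacter ℂ q} (hprim : χ.IsPrimitive) (hquad : χ.IsQuadratic) (hodd : χ.Odd)
    {β : ℝ} (hzero : χ.LFunction β = 0) :
    Real.pi / (Real.sqrt q * Real.log q ^ 2) ≤ 1 - β := by
  have hq' : (1600 : ℝ) ≤ q := by exact_mod_cast hq
  have hq0 : (0 : ℝ) < q := by linarith
  have hL7 := seven_lt_log' hq
  have hL0 : 0 < Real.log q := by linarith
  have hsq40 : 40 ≤ Real.sqrt q := by
    rw [show (40 : ℝ) = Real.sqrt (40 ^ 2) by rw [Real.sqrt_sq (by norm_num)]]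
    exact Real.sqrt_le_sqrt (by norm_num; linarith)
  have hsq : 0 < Real.sqrt q := by linarith
  have hden : 0 < Real.sqrt q * Real.log q ^ 2 := by positivity
  have hπ := pi_lt_315
  have hπ0 := Real.pi_pos
  set r : ℝ := 1 / (40 * Real.log q) with hrdef
  by_cases hfar : β < 1 - r
  · have h1 : Real.pi / (Real.sqrt q * Real.log q ^ 2) ≤ r := by
      rw [hrdef, div_le_div_iff₀ hden (by positivity)]
      -- `40 π log q ≤ √q log² q` since `√q log q ≥ 280 > 40π`
      have : 40 * Real.pi ≤ Real.sqrt q * Real.log q := by nlinarith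
      nlinarith
    linarith
  · rw [not_lt] at hfar
    have hup := DirichletAbel.norm_LFunction_one_le_log_sq_of_realZero (by omega) hprim hfar hzero
    have hfloor := sqrt_mul_norm_LFunction_one_ge_pi_of_odd (by omega) hprim hquad hodd
    have key : Real.pi ≤ Real.sqrt q * ((1 - β) * Real.log q ^ 2) :=
      hfloor.trans (mul_le_mul_of_nonneg_left hup hsq.le)
    rw [div_le_iff₀ hden]
    nlinarith

/-- **Odd characters, `q ≥ 10⁶`: `1 − β ≥ (50π/23)/(√q (log q)²)`** (`≈ 6.83/(√q log²q)`; the kernel's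
derivative constant `0.46`). [cite: MontgomeryVaughan2007, Theorem 11.4 (11.10)] [cite: NeukirchANT1999, Ch. VII §5 (5.11)] -/
theorem one_sub_realZero_ge_pi_of_odd_of_ge_1e6 {q : ℕ} [NeZero q] (hq : 10 ^ 6 ≤ q)
    {χ : DirichletCharacter ℂ q} (hprim : χ.IsPrimitive) (hquad : χ.IsQuadratic) (hodd : χ.Odd)
    {β : ℝ} (hzero : χ.LFunction β = 0) :
    50 * Real.pi / 23 / (Real.sqrt q * Real.log q ^ 2) ≤ 1 - β := by
  have hq1600 : 1600 ≤ q := le_trans (by norm_num) hq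
  have hq' : (10 : ℝ) ^ 6 ≤ q := by exact_mod_cast hq
  have hq0 : (0 : ℝ) < q := by linarith
  have hne : χ ≠ 1 := by
    rintro rfl
    rw [DirichletCharacter.isPrimitive_def, DirichletCharacter.conductor_one] at hprim
    omega
  have hβ1 : β < 1 := by
    by_contra hcon
    exact DirichletCharacter.LFunction_ne_zero_of_one_le_re χ (Or.inl hne) (s := β)
      (by simp; linarith) hzero
  have hL7 := seven_lt_log' hq1600
  have hL0 : 0 < Real.log q := by linarith
  have hsq1000 : 1000 ≤ Real.sqrt q := by
    rw [show (1000 : ℝ) = Real.sqrt (1000 ^ 2) by rw [Real.sqrt_sq (by norm_num)]]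
    exact Real.sqrt_le_sqrt (by norm_num at hq' ⊢; linarith)
  have hsq : 0 < Real.sqrt q := by linarith
  have hden : 0 < Real.sqrt q * Real.log q ^ 2 := by positivity
  have hπ := pi_lt_315
  have hπ0 := Real.pi_pos
  set r : ℝ := 1 / (40 * Real.log q) with hrdef
  by_cases hfar : β < 1 - r
  · have h1 : 50 * Real.pi / 23 / (Real.sqrt q * Real.log q ^ 2) ≤ r := by
      rw [hrdef, div_le_div_iff₀ hden (by positivity)]
      have : 50 * Real.pi / 23 * 40 ≤ Real.sqrt q * Real.log q := by
        have h' : 50 * Real.pi / 23 * 40 ≤ 280 := by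
          rw [div_mul_eq_mul_div, div_le_iff₀ (by norm_num : (0:ℝ) < 23)]; nlinarith
        nlinarith
      nlinarith
    linarith
  · rw [not_lt] at hfar
    have h := DirichletAbel.norm_LFunction_one_sub_le_of_norm_deriv_le χ hne hβ1.le fun σ h1 h2 =>
      DirichletAbel.norm_deriv_LFunction_le_log_sq_of_ge_1e6 hq hprim (le_trans hfar h1) h2
    rw [hzero, sub_zero] at h
    have hfloor := sqrt_mul_norm_LFunction_one_ge_pi_of_odd (by omega) hprim hquad hodd
    have key : Real.pi ≤ Real.sqrt q * (23 / 50 * Real.log q ^ 2 * (1 - β)) :=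
      hfloor.trans (mul_le_mul_of_nonneg_left h hsq.le)
    rw [div_le_iff₀ hden]
    -- `key`: `π ≤ (23/50) · √q log²q · (1−β)`; multiply by `50/23`
    have hprod : 0 ≤ Real.sqrt q * Real.log q ^ 2 * (1 - β) := by
      have : 0 ≤ 1 - β := by linarith
      positivity
    nlinarith

/-- **Quality cap for odd characters: `η ≤ √q log q/π`** (conductor `q ≥ 1600`; both-parity kernel cap
`(3/2)√q log q`). [cite: TaoTeravainen2021, Definition 1.4] [cite: NeukirchANT1999, Ch. VII §5 (5.11)] -/
theorem isSiegelZero_quality_le_of_odd {q : ℕ} [NeZero q] (hq : 1600 ≤ q)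
    {χ : DirichletCharacter ℂ q} (hodd : χ.Odd) {η : ℝ} (hS : IsSiegelZero χ η) :
    η ≤ Real.sqrt q * Real.log q / Real.pi := by
  obtain ⟨hprim, hquad, h10, hzero⟩ := hS
  have hq' : (1600 : ℝ) ≤ q := by exact_mod_cast hq
  have hL0 : 0 < Real.log q := by linarith [seven_lt_log' hq]
  have hη : 0 < η := by linarith
  have hsq : 0 < Real.sqrt q := Real.sqrt_pos.mpr (by linarith)
  have hπ0 := Real.pi_pos
  have h := one_sub_realZero_ge_pi_of_odd hq hprim hquad hodd hzero
  have hβ : 1 - (1 - 1 / (η * Real.log q)) = 1 / (η * Real.log q) := by ring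
  rw [hβ, div_le_div_iff₀ (by positivity) (by positivity)] at h
  rw [le_div_iff₀ hπ0]
  -- h : π · (η log q) ≤ 1 · (√q log² q)
  nlinarith

/-- **Conductor floor for odd characters: `π η ≤ √q log q`** — a Siegel zero of quality `η` at an odd
character needs a conductor with `√q log q ≥ πη`. [cite: TaoTeravainen2021, Definition 1.4]
[cite: NeukirchANT1999, Ch. VII §5 (5.11)] -/
theorem isSiegelZero_conductor_ge_of_odd {q : ℕ} [NeZero q] (hq : 1600 ≤ q)
    {χ : DirichletCharacter ℂ q} (hodd : χ.Odd) {η : ℝ} (hS : IsSiegelZero χ η) :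
    Real.pi * η ≤ Real.sqrt q * Real.log q := by
  have h := isSiegelZero_quality_le_of_odd hq hodd hS
  have hπ0 := Real.pi_pos
  rw [le_div_iff₀ hπ0] at h
  linarith


/-! ### Appended 2026-08-27: both parities — TARGET §2 row 16 v3 -/

/-- **Kernel repulsion v3, both parities: `1 − β ≥ π/(√q (log q)²)`** for every primitive quadratic `χ`
mod `q ≥ 1600` and every real zero `β` — odd: the floor `π`; even: the floor `log(q/4) ≥ log 400 > π`.
(v2, `RealZeroEffectiveRepulsionExplicitII.lean`: `2/(3 √q log²q)` for all `q ≥ 3`.)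
[cite: MontgomeryVaughan2007, Theorem 11.4 (11.10)] [cite: NeukirchANT1999, Ch. VII §5 (5.11)] -/
theorem one_sub_realZero_ge_pi {q : ℕ} [NeZero q] (hq : 1600 ≤ q)
    {χ : DirichletCharacter ℂ q} (hprim : χ.IsPrimitive) (hquad : χ.IsQuadratic)
    {β : ℝ} (hzero : χ.LFunction β = 0) :
    Real.pi / (Real.sqrt q * Real.log q ^ 2) ≤ 1 - β := by
  rcases χ.even_or_odd with heven | hodd
  · refine le_trans ?_ (one_sub_realZero_ge_log_of_even hq hprim hquad heven hzero)
    have hq' : (1600 : ℝ) ≤ q := by exact_mod_cast hq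
    have hL0 : 0 < Real.log q := by linarith [seven_lt_log' hq]
    have hsq : 0 < Real.sqrt q := Real.sqrt_pos.mpr (by linarith)
    apply div_le_div_of_nonneg_right _ (by positivity)
    -- `π < 3.15 < 5.9 < log 400 ≤ log(q/4)`: `log 400 ≥ log(e^5)` as `e^5 < 149 < 400`
    have h400 : (400 : ℝ) ≤ (q : ℝ) / 4 := by linarith
    have hlog : Real.log 400 ≤ Real.log ((q : ℝ) / 4) := Real.log_le_log (by norm_num) h400
    have h5 : (5 : ℝ) < Real.log 400 := by
      rw [Real.lt_log_iff_exp_lt (by norm_num)]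
      have h1 : Real.exp (1 : ℝ) < 2.7182818286 := Real.exp_one_lt_d9
      have h7 : Real.exp (5 : ℝ) = Real.exp 1 ^ 5 := by rw [Real.exp_one_pow]; norm_num
      rw [h7]
      have h0 : 0 < Real.exp (1 : ℝ) := Real.exp_pos 1
      nlinarith [pow_le_pow_left₀ h0.le h1.le 5]
    have hπ := pi_lt_315
    linarith
  · exact one_sub_realZero_ge_pi_of_odd hq hprim hquad hodd hzero

/-- **Both parities, `q ≥ 10⁶`: `1 − β ≥ (50π/23)/(√q (log q)²)`** (`≈ 6.83`; v2: `3/2`).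
[cite: MontgomeryVaughan2007, Theorem 11.4 (11.10)] [cite: NeukirchANT1999, Ch. VII §5 (5.11)] -/
theorem one_sub_realZero_ge_pi_of_ge_1e6 {q : ℕ} [NeZero q] (hq : 10 ^ 6 ≤ q)
    {χ : DirichletCharacter ℂ q} (hprim : χ.IsPrimitive) (hquad : χ.IsQuadratic)
    {β : ℝ} (hzero : χ.LFunction β = 0) :
    50 * Real.pi / 23 / (Real.sqrt q * Real.log q ^ 2) ≤ 1 - β := by
  rcases χ.even_or_odd with heven | hodd
  · refine le_trans ?_ (one_sub_realZero_ge_log_of_even_of_ge_1e6 hq hprim hquad heven hzero)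
    have hq' : (10 : ℝ) ^ 6 ≤ q := by exact_mod_cast hq
    have hL0 : 0 < Real.log q := by linarith [seven_lt_log' (le_trans (by norm_num) hq)]
    have hsq : 0 < Real.sqrt q := Real.sqrt_pos.mpr (by linarith)
    apply div_le_div_of_nonneg_right _ (by positivity)
    have h400 : (400 : ℝ) ≤ (q : ℝ) / 4 := by linarith
    have hlog : Real.log 400 ≤ Real.log ((q : ℝ) / 4) := Real.log_le_log (by norm_num) h400
    have h5 : (5 : ℝ) < Real.log 400 := by
      rw [Real.lt_log_iff_exp_lt (by norm_num)]
      have h1 : Real.exp (1 : ℝ) < 2.7182818286 := Real.exp_one_lt_d9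
      have h7 : Real.exp (5 : ℝ) = Real.exp 1 ^ 5 := by rw [Real.exp_one_pow]; norm_num
      rw [h7]
      have h0 : 0 < Real.exp (1 : ℝ) := Real.exp_pos 1
      nlinarith [pow_le_pow_left₀ h0.le h1.le 5]
    have hπ := pi_lt_315
    have : 50 * Real.pi / 23 ≤ 50 / 23 * Real.log ((q : ℝ) / 4) := by
      rw [div_le_iff₀ (by norm_num : (0:ℝ) < 23)]; nlinarith
    linarith
  · exact one_sub_realZero_ge_pi_of_odd_of_ge_1e6 hq hprim hquad hodd hzero

/-- **Quality cap v3, both parities: `η ≤ √q log q/π`** for a Siegel zero at a conductor `q ≥ 1600`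
(v2: `(3/2)√q log q`), and hence the conductor floor `πη ≤ √q log q`.
[cite: TaoTeravainen2021, Definition 1.4] [cite: NeukirchANT1999, Ch. VII §5 (5.11)] -/
theorem isSiegelZero_quality_le_pi {q : ℕ} [NeZero q] (hq : 1600 ≤ q)
    {χ : DirichletCharacter ℂ q} {η : ℝ} (hS : IsSiegelZero χ η) :
    η ≤ Real.sqrt q * Real.log q / Real.pi ∧ Real.pi * η ≤ Real.sqrt q * Real.log q := by
  obtain ⟨hprim, hquad, h10, hzero⟩ := hS
  have hq' : (1600 : ℝ) ≤ q := by exact_mod_cast hq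
  have hL0 : 0 < Real.log q := by linarith [seven_lt_log' hq]
  have hη : 0 < η := by linarith
  have hsq : 0 < Real.sqrt q := Real.sqrt_pos.mpr (by linarith)
  have hπ0 := Real.pi_pos
  have h := one_sub_realZero_ge_pi hq hprim hquad hzero
  have hβ : 1 - (1 - 1 / (η * Real.log q)) = 1 / (η * Real.log q) := by ring
  rw [hβ, div_le_div_iff₀ (by positivity) (by positivity)] at h
  have h2 : Real.pi * η ≤ Real.sqrt q * Real.log q := by nlinarith
  refine ⟨?_, h2⟩
  rw [le_div_iff₀ hπ0]; linarith

end RealZeroRepulsion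

end Literature.NumberTheory.LFunctions

end
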